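import Summits.MatrixMultiplication.OmegaCensus.STPPSmallPatternKernelReflect122P

/-!
# ω-census, small STPP pattern `(1,2,2)^k`: kernel search with PAIR-CLASS PRUNING and two chunk levels (engine + level reflection)

HONEST FRAMING (pub-omega census; verbatim): lottery ticket; floor = certified bounds/negative ranges.
Census STRUCTURE bookkeeping of the STPP track (seat pub-omega-stpp-3, gen 25; STRUCTURE row B5, column `T2`), not progress on `ω`.

The `(1,2,2)` kernel search `STPP122Neg.search2/search2x/search2xx` refutes the difference model in the normal form «triple `0`
is ANY triple of the solution».  This file adds the engine for the sharper normal form of `STPPSmallPatternKernelReflect122R.lean`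
(«triple `0` is the triple whose pair of differences `(b'₀ − b₀, c'₀ − c₀)` has the LEAST pair-class rank among all `2k`
flags of the solution»): every later triple `(b, b', c, c')` placed by the search must have its difference pair
`(b' − b, c' − c)` outside a per-start FORBIDDEN-PAIR mask `PP` (bit `(b' − b)·n + (c' − c)`), with the one-sided shadows
`XB` (forbidden `b' − b` codes: prunes `b'` directly) and `XC` (forbidden `c' − c` codes: prunes `c'`).  The start `(y, c'₀)` is
fixed per entry and its second level may be chunked by exclusion masks on the codes of `b₁` AND of `b'₁` (`xb`, `xb2`).

* `level2r g XB XC PP S k`, `level2rm … S xb xb2 k`, `below2r`, `start2r g XB XC PP y z xb xb2 r`, `search2r g k entries`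
  (entry = `(y, z, xb, xb2, XB, XC, PP)`; `r = k − 2` triples below the first two).
* Reflection of one level / one start along a solution whose every triple has an allowed difference pair
  (`PairOK`): `level2r_false`, `level2rm_false`, `below2r_false`, `start2r_false`, `start2r_of_search2r`.

References: H. Cohn, R. Kleinberg, B. Szegedy, C. Umans, FOCS 2005 (arXiv:math/0511460), Def. 5.1.  Record: pub-omega HOME
`pub-omega-stpp-3-g25/` (Python mirror `probe_tasks.py` / planner `plan25*.py` give the subtree costs).
-/

namespace Summit.MatrixMultiplication.OmegaCensus

namespace STPP122Neg

open STPP211Neg Literature.Computability.AlgebraicComplexity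

/-! ## Engine -/

/-- One level below the state `S` with PAIR-CLASS PRUNING: `b'` avoids `b + XB`, `c'` avoids `c + XC`, and a candidate triple
whose difference pair bit `(b' − b)·n + (c' − c)` is set in `PP` is skipped; otherwise identical to `level2` (children
searched by `k`). -/
noncomputable def level2r (g : GC) (XB XC PP : ℕ) (S : St2) (k : St2 → Bool) : Bool :=
  force (Nat.xor g.full (Nat.lor (Nat.lor S.BS S.PB) (Nat.land (lowMask (Nat.add S.lastB 1)) g.full))) fun freeB =>
  allBits freeB (fun b =>
    force (g.tr S.NIM b) fun NIMb =>
    force (Nat.xor g.full (Nat.lor (Nat.lor (Nat.xor g.full freeB) (Nat.land (lowMask (Nat.add b 1)) g.full))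
      (g.tr (Nat.land XB g.full) b))) fun freeB' =>
    allBits freeB' (fun b' =>
      force (Nat.mul (g.sub b' b) g.n) fun pb =>
      force (Nat.xor g.full (Nat.lor (Nat.lor (Nat.lor S.CS S.PC) NIMb) (g.tr S.NIM b'))) fun freeC =>
      allBits freeC (fun c =>
        force (Nat.xor g.full (Nat.lor (Nat.lor (Nat.xor g.full freeC) (Nat.land (lowMask (Nat.add c 1)) g.full))
          (g.tr (Nat.land XC g.full) c))) fun freeC' =>
        allBits freeC' (fun c' => Nat.testBit PP (Nat.add pb (g.sub c' c)) ||
          (!(validNew g S b b' c c') || child2 g S b b' c c' k)) freeC')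
        freeC)
      freeB')
    freeB

/-- The same level with the codes of `b` additionally outside `xb` and the codes of `b'` outside `xb2` (the two chunk masks of
the level right below a fixed start). -/
noncomputable def level2rm (g : GC) (XB XC PP : ℕ) (S : St2) (xb xb2 : ℕ) (k : St2 → Bool) : Bool :=
  force (Nat.xor g.full (Nat.lor (Nat.lor S.BS S.PB) (Nat.land (lowMask (Nat.add S.lastB 1)) g.full))) fun freeB =>
  force (Nat.land freeB (Nat.xor g.full xb)) fun freeBm =>
  allBits freeBm (fun b =>
    force (g.tr S.NIM b) fun NIMb =>
    force (Nat.xor g.full (Nat.lor (Nat.lor (Nat.xor g.full freeB) (Nat.land (lowMask (Nat.add b 1)) g.full))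
      (g.tr (Nat.land XB g.full) b))) fun freeB' =>
    force (Nat.land freeB' (Nat.xor g.full xb2)) fun freeB'm =>
    allBits freeB'm (fun b' =>
      force (Nat.mul (g.sub b' b) g.n) fun pb =>
      force (Nat.xor g.full (Nat.lor (Nat.lor (Nat.lor S.CS S.PC) NIMb) (g.tr S.NIM b'))) fun freeC =>
      allBits freeC (fun c =>
        force (Nat.xor g.full (Nat.lor (Nat.lor (Nat.xor g.full freeC) (Nat.land (lowMask (Nat.add c 1)) g.full))
          (g.tr (Nat.land XC g.full) c))) fun freeC' =>
        allBits freeC' (fun c' => Nat.testBit PP (Nat.add pb (g.sub c' c)) ||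
          (!(validNew g S b b' c c') || child2 g S b b' c c' k)) freeC')
        freeC)
      freeB'm)
    freeBm

/-- The pruned search below a state with `r` triples still to place (`false` when nothing is left: a full configuration). -/
noncomputable def below2r (g : GC) (XB XC PP : ℕ) : ℕ → St2 → Bool :=
  @Nat.rec (fun _ => St2 → Bool) (fun _ => false) (fun _ ih S => level2r g XB XC PP S ih)

/-- THE FIXED START `(y, z)` (`B₀ = {0, y}`, `C₀ = {0, z}`) with pair-class pruning, whose next level excludes the `b₁`-codes in
`xb` and the `b'₁`-codes in `xb2`, continued by `below2r … r` (`r` = number of triples left after the first two). -/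
noncomputable def start2r (g : GC) (XB XC PP y z xb xb2 r : ℕ) : Bool :=
  !(validNew g St2.empty 0 y 0 z) || child2 g St2.empty 0 y 0 z (fun S => level2rm g XB XC PP S xb xb2 (below2r g XB XC PP r))

/-- THE PRUNED, TWO-LEVEL-CHUNKED SEARCH over entries `(y, z, xb, xb2, XB, XC, PP)`: `true` certifies that no normal-form solution
with `B₀ = {0, y}`, `C₀ = {0, z}`, the code of `b₁` outside `xb`, the code of `b'₁` outside `xb2`, and every triple's
difference pair allowed by `(XB, XC, PP)` exists (`k ≥ 2` triples). -/
noncomputable def search2r (g : GC) (k : ℕ) (entries : List (ℕ × ℕ × ℕ × ℕ × ℕ × ℕ × ℕ)) : Bool :=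
  @List.rec (ℕ × ℕ × ℕ × ℕ × ℕ × ℕ × ℕ) (fun _ => Bool) true
    (fun e _ ih => start2r g e.2.2.2.2.1 e.2.2.2.2.2.1 e.2.2.2.2.2.2 e.1 e.2.1 e.2.2.1 e.2.2.2.1 (Nat.sub k 2) && ih) entries

/-- `search2r` on a cons. -/
theorem search2r_cons (g : GC) (k : ℕ) (e : ℕ × ℕ × ℕ × ℕ × ℕ × ℕ × ℕ) (R : List (ℕ × ℕ × ℕ × ℕ × ℕ × ℕ × ℕ)) :
    search2r g k (e :: R) =
      (start2r g e.2.2.2.2.1 e.2.2.2.2.2.1 e.2.2.2.2.2.2 e.1 e.2.1 e.2.2.1 e.2.2.2.1 (k - 2) && search2r g k R) := rfl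

/-- `search2r` is a conjunction over the entry list. -/
theorem search2r_append (g : GC) (k : ℕ) (R₁ R₂ : List (ℕ × ℕ × ℕ × ℕ × ℕ × ℕ × ℕ)) :
    search2r g k (R₁ ++ R₂) = (search2r g k R₁ && search2r g k R₂) := by
  induction R₁ with
  | nil => rfl
  | cons e R ih => rw [List.cons_append, search2r_cons, search2r_cons, ih, Bool.and_assoc]

/-- A `true` pruned search refutes every listed entry. -/
theorem start2r_of_search2r {g : GC} {k : ℕ} : ∀ {R : List (ℕ × ℕ × ℕ × ℕ × ℕ × ℕ × ℕ)}, search2r g k R = true → ∀ e ∈ R,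
    start2r g e.2.2.2.2.1 e.2.2.2.2.2.1 e.2.2.2.2.2.2 e.1 e.2.1 e.2.2.1 e.2.2.2.1 (k - 2) = true := by
  intro R
  induction R with
  | nil => intro _ e he; simp at he
  | cons e' R ih =>
      intro h e he
      rw [search2r_cons, Bool.and_eq_true] at h
      rcases List.mem_cons.1 he with rfl | he
      · exact h.1
      · exact ih h.2 e he

/-! ## Reflection of one level and of one start -/

section Refl

variable {G : Type} [AddCommGroup G] {E : GEnc G} {K : ℕ} {b b' c c' : Fin K → G}

/-- The solution's triples have ALLOWED difference pairs with respect to `(XB, XC, PP)`: the code of `b'ᵢ − bᵢ` is clear in `XB`,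
the code of `c'ᵢ − cᵢ` is clear in `XC`, and the pair bit `enc (b'ᵢ − bᵢ) · n + enc (c'ᵢ − cᵢ)` is clear in `PP`. -/
def PairOK (E : GEnc G) (XB XC PP : ℕ) (b b' c c' : Fin K → G) : Prop :=
  ∀ i, XB.testBit (E.enc (b' i - b i)) = false ∧ XC.testBit (E.enc (c' i - c i)) = false ∧
    PP.testBit (E.enc (b' i - b i) * E.g.n + E.enc (c' i - c i)) = false

/-- The free-`b'` mask of `level2r`. -/
def fB2r (g : GC) (XB : ℕ) (S : St2) (b : ℕ) : ℕ :=
  Nat.xor g.full (Nat.lor (Nat.lor (Nat.xor g.full (fB g S)) (Nat.land (lowMask (Nat.add b 1)) g.full))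
    (g.tr (Nat.land XB g.full) b))

/-- The free-`c'` mask of `level2r`. -/
def fC2r (g : GC) (XC : ℕ) (S : St2) (b b' c : ℕ) : ℕ :=
  Nat.xor g.full (Nat.lor (Nat.lor (Nat.xor g.full (fC g S b b')) (Nat.land (lowMask (Nat.add c 1)) g.full))
    (g.tr (Nat.land XC g.full) c))

/-- The innermost body of `level2r` / `level2rm`. -/
noncomputable def bodyR (g : GC) (PP : ℕ) (S : St2) (k : St2 → Bool) (b b' c c' : ℕ) : Bool :=
  Nat.testBit PP (Nat.add (Nat.mul (g.sub b' b) g.n) (g.sub c' c)) || (!(validNew g S b b' c c') || child2 g S b b' c c' k)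

/-- `level2r` unfolded. -/
theorem level2r_eq (g : GC) (XB XC PP : ℕ) (S : St2) (k : St2 → Bool) :
    level2r g XB XC PP S k = allBits (fB g S) (fun b => allBits (fB2r g XB S b) (fun b' => allBits (fC g S b b') (fun c =>
      allBits (fC2r g XC S b b' c) (fun c' => bodyR g PP S k b b' c c') (fC2r g XC S b b' c))
      (fC g S b b')) (fB2r g XB S b)) (fB g S) := by
  unfold level2r fB fB2r fC fC2r bodyR fB fC; simp only [force_eq]

/-- The masked free-`b` mask of `level2rm`. -/
def fBmr (g : GC) (S : St2) (xb : ℕ) : ℕ := Nat.land (fB g S) (Nat.xor g.full xb)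

/-- The masked free-`b'` mask of `level2rm`. -/
def fB2mr (g : GC) (XB : ℕ) (S : St2) (xb2 b : ℕ) : ℕ := Nat.land (fB2r g XB S b) (Nat.xor g.full xb2)

/-- `level2rm` unfolded. -/
theorem level2rm_eq (g : GC) (XB XC PP : ℕ) (S : St2) (xb xb2 : ℕ) (k : St2 → Bool) :
    level2rm g XB XC PP S xb xb2 k = allBits (fBmr g S xb) (fun b => allBits (fB2mr g XB S xb2 b) (fun b' =>
      allBits (fC g S b b') (fun c => allBits (fC2r g XC S b b' c) (fun c' => bodyR g PP S k b b' c c') (fC2r g XC S b b' c))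
      (fC g S b b')) (fB2mr g XB S xb2 b)) (fBmr g S xb) := by
  unfold level2rm fBmr fB2mr fB fB2r fC fC2r bodyR fB fC; simp only [force_eq]

/-- A translate of a FORBIDDEN-DIFFERENCE mask misses the solution's element: if the code of `x − t` is clear in `X`, then the
code of `x` is clear in `(X &&& full) + t`. -/
theorem testBit_tr_land_full_eq_false {X : ℕ} {t x : G} (h : X.testBit (E.enc (x - t)) = false) :
    (E.g.tr (Nat.land X E.g.full) (E.enc t)).testBit (E.enc x) = false := by
  cases hb : (E.g.tr (Nat.land X E.g.full) (E.enc t)).testBit (E.enc x)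
  · rfl
  · exfalso
    have hlt : Nat.land X E.g.full < 2 ^ E.g.n := by
      rw [land_eq, E.full_eq]; exact Nat.and_lt_two_pow _ (Nat.sub_lt (Nat.two_pow_pos _) Nat.one_pos)
    obtain ⟨x', hx', hxt⟩ := E.tr_spec _ t x hlt hb
    have : x' = x - t := by rw [hxt]; abel
    rw [this, land_eq, Nat.testBit_land, h] at hx'
    simp at hx'

/-- Along the solution: the `B`-elements of the `m`-th triple are free `b`-codes. -/
theorem fB_true (hM : ModelD2 b b' c c') (hNF : NF2 E b b' c c') {m : ℕ} (im : Fin K) (him : im.val = m) (ip : Fin K)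
    (hip : ip.val + 1 = m) {S : St2} (hS : InvM2 E b b' c c' m S) (hlast : S.lastB = E.enc (b ip)) {t : G}
    (ht : InA b b' im t) : (fB E.g S).testBit (E.enc t) = true := by
  unfold fB
  rw [testBit_fullXor, lor_eq, lor_eq, Nat.testBit_lor, Nat.testBit_lor, hS.bs_free hM im him ht, hS.pb_free hM im him ht,
    testBit_lowMask_land, add_eq', hlast]
  have h1 := hNF.1 ip im (by rw [Fin.lt_def]; omega)
  have h2 : E.enc (b im) ≤ E.enc t := by
    rcases ht with rfl | rfl
    · exact le_rfl
    · exact le_of_lt (hNF.2.1 im)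
  simp; omega

/-- Along the solution: `b'ₘ` is a free `b'`-code of the pruned level. -/
theorem fB2r_true (hM : ModelD2 b b' c c') (hNF : NF2 E b b' c c') {XB XC PP : ℕ} (hP : PairOK E XB XC PP b b' c c')
    {m : ℕ} (im : Fin K) (him : im.val = m) (ip : Fin K) (hip : ip.val + 1 = m) {S : St2} (hS : InvM2 E b b' c c' m S)
    (hlast : S.lastB = E.enc (b ip)) : (fB2r E.g XB S (E.enc (b im))).testBit (E.enc (b' im)) = true := by
  unfold fB2r
  rw [testBit_fullXor, lor_eq, lor_eq, Nat.testBit_lor, Nat.testBit_lor, testBit_fullXor,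
    fB_true hM hNF im him ip hip hS hlast (inA_q im), testBit_lowMask_land, add_eq', testBit_tr_land_full_eq_false (hP im).1]
  have := hNF.2.1 im
  simp; omega

/-- Along the solution: the `C`-elements of the `m`-th triple are free `c`-codes. -/
theorem fC_true (hM : ModelD2 b b' c c') {m : ℕ} (im : Fin K) (him : im.val = m) {S : St2} (hS : InvM2 E b b' c c' m S)
    {u : G} (hu : InA c c' im u) : (fC E.g S (E.enc (b im)) (E.enc (b' im))).testBit (E.enc u) = true := by
  unfold fC
  rw [testBit_fullXor, lor_eq, lor_eq, lor_eq, Nat.testBit_lor, Nat.testBit_lor, Nat.testBit_lor,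
    hS.cs_free hM im him hu, hS.pc_free hM im him hu, hS.nim_free hM im him (inA_p im) hu,
    hS.nim_free hM im him (inA_q im) hu]; rfl

/-- Along the solution: `c'ₘ` is a free `c'`-code of the pruned level. -/
theorem fC2r_true (hM : ModelD2 b b' c c') (hNF : NF2 E b b' c c') {XB XC PP : ℕ} (hP : PairOK E XB XC PP b b' c c')
    {m : ℕ} (im : Fin K) (him : im.val = m) {S : St2} (hS : InvM2 E b b' c c' m S) :
    (fC2r E.g XC S (E.enc (b im)) (E.enc (b' im)) (E.enc (c im))).testBit (E.enc (c' im)) = true := by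
  unfold fC2r
  rw [testBit_fullXor, lor_eq, lor_eq, Nat.testBit_lor, Nat.testBit_lor, testBit_fullXor,
    fC_true hM im him hS (inA_q im), testBit_lowMask_land, add_eq', testBit_tr_land_full_eq_false (hP im).2.1]
  have := hNF.2.2 im
  simp; omega

/-- Along the solution: the innermost body answers `false` on the `m`-th triple. -/
theorem bodyR_false (hM : ModelD2 b b' c c') {XB XC PP : ℕ} (hP : PairOK E XB XC PP b b' c c') {m : ℕ} (im : Fin K)
    (him : im.val = m) {S : St2} (hS : InvM2 E b b' c c' m S) {k : St2 → Bool}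
    (hk : ∀ S', InvM2 E b b' c c' (m + 1) S' → S'.lastB = E.enc (b im) → k S' = false) :
    bodyR E.g PP S k (E.enc (b im)) (E.enc (b' im)) (E.enc (c im)) (E.enc (c' im)) = false := by
  unfold bodyR
  rw [add_eq', mul_eq', E.sub_enc, E.sub_enc, (hP im).2.2, validNew_true hM hS im him, child2_eq,
    hk _ (invM2_childSt2 im him hS) rfl]; rfl

/-- ONE PRUNED LEVEL OF THE SOLUTION'S BRANCH IS NOT REFUTED (`m ≥ 1` triples placed, the `m`-th next). -/
theorem level2r_false (hM : ModelD2 b b' c c') (hNF : NF2 E b b' c c') {XB XC PP : ℕ} (hP : PairOK E XB XC PP b b' c c')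
    {m : ℕ} (im : Fin K) (him : im.val = m) (ip : Fin K) (hip : ip.val + 1 = m) {S : St2} (hS : InvM2 E b b' c c' m S)
    (hlast : S.lastB = E.enc (b ip)) {k : St2 → Bool}
    (hk : ∀ S', InvM2 E b b' c c' (m + 1) S' → S'.lastB = E.enc (b im) → k S' = false) :
    level2r E.g XB XC PP S k = false := by
  rw [level2r_eq]
  cases h : allBits (fB E.g S) _ (fB E.g S)
  · rfl
  exfalso
  have h1 := allBits_spec _ _ _ le_rfl h _ (fB_true hM hNF im him ip hip hS hlast (inA_p im))
  have h2 := allBits_spec _ _ _ le_rfl h1 _ (fB2r_true hM hNF hP im him ip hip hS hlast)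
  have h3 := allBits_spec _ _ _ le_rfl h2 _ (fC_true hM im him hS (inA_p im))
  have h4 := allBits_spec _ _ _ le_rfl h3 _ (fC2r_true hM hNF hP im him hS)
  rw [bodyR_false hM hP im him hS hk] at h4
  exact Bool.false_ne_true h4

/-- ONE PRUNED, MASKED LEVEL OF THE SOLUTION'S BRANCH IS NOT REFUTED when the masks miss the codes of `bₘ` and `b'ₘ`. -/
theorem level2rm_false (hM : ModelD2 b b' c c') (hNF : NF2 E b b' c c') {XB XC PP : ℕ} (hP : PairOK E XB XC PP b b' c c')
    {m : ℕ} (im : Fin K) (him : im.val = m) (ip : Fin K) (hip : ip.val + 1 = m) {S : St2} (hS : InvM2 E b b' c c' m S)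
    (hlast : S.lastB = E.enc (b ip)) {k : St2 → Bool}
    (hk : ∀ S', InvM2 E b b' c c' (m + 1) S' → S'.lastB = E.enc (b im) → k S' = false)
    {xb xb2 : ℕ} (hxb : xb.testBit (E.enc (b im)) = false) (hxb2 : xb2.testBit (E.enc (b' im)) = false) :
    level2rm E.g XB XC PP S xb xb2 k = false := by
  rw [level2rm_eq]
  have hb : (fBmr E.g S xb).testBit (E.enc (b im)) = true := by
    unfold fBmr
    rw [land_eq, Nat.testBit_land, fB_true hM hNF im him ip hip hS hlast (inA_p im), testBit_fullXor, hxb]; rfl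
  have hb' : (fB2mr E.g XB S xb2 (E.enc (b im))).testBit (E.enc (b' im)) = true := by
    unfold fB2mr
    rw [land_eq, Nat.testBit_land, fB2r_true hM hNF hP im him ip hip hS hlast, testBit_fullXor, hxb2]; rfl
  cases h : allBits (fBmr E.g S xb) _ (fBmr E.g S xb)
  · rfl
  exfalso
  have h1 := allBits_spec _ _ _ le_rfl h _ hb
  have h2 := allBits_spec _ _ _ le_rfl h1 _ hb'
  have h3 := allBits_spec _ _ _ le_rfl h2 _ (fC_true hM im him hS (inA_p im))
  have h4 := allBits_spec _ _ _ le_rfl h3 _ (fC2r_true hM hNF hP im him hS)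
  rw [bodyR_false hM hP im him hS hk] at h4
  exact Bool.false_ne_true h4

/-- THE PRUNED SEARCH BELOW A STATE OF THE SOLUTION'S BRANCH ANSWERS `false`. -/
theorem below2r_false (hM : ModelD2 b b' c c') (hNF : NF2 E b b' c c') {XB XC PP : ℕ} (hP : PairOK E XB XC PP b b' c c') :
    ∀ (r m : ℕ) (ip : Fin K) (S : St2), m + r = K → ip.val + 1 = m → InvM2 E b b' c c' m S → S.lastB = E.enc (b ip) →
      below2r E.g XB XC PP r S = false := by
  intro r
  induction r with
  | zero => intro m ip S _ _ _ _; rfl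
  | succ r ih =>
      intro m ip S hmr hip hS hlast
      have hmK : m < K := by omega
      show level2r E.g XB XC PP S (below2r E.g XB XC PP r) = false
      exact level2r_false hM hNF hP ⟨m, hmK⟩ rfl ip hip hS hlast
        fun S' hS' hl' => ih (m + 1) ⟨m, hmK⟩ S' (by omega) rfl hS' hl'

/-- THE FIXED, PRUNED START OF THE SOLUTION ANSWERS `false` when the chunk masks miss the codes of `b₁`, `b'₁` (`K ≥ 2`). -/
theorem start2r_false (hM : ModelD2 b b' c c') (hNF : NF2 E b b' c c') {XB XC PP : ℕ} (hP : PairOK E XB XC PP b b' c c')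
    (hK : 2 ≤ K) (hb0 : b ⟨0, by omega⟩ = 0) (hc0 : c ⟨0, by omega⟩ = 0) {xb xb2 : ℕ}
    (hxb : xb.testBit (E.enc (b ⟨1, hK⟩)) = false) (hxb2 : xb2.testBit (E.enc (b' ⟨1, hK⟩)) = false) :
    start2r E.g XB XC PP (E.enc (b' ⟨0, by omega⟩)) (E.enc (c' ⟨0, by omega⟩)) xb xb2 (K - 2) = false := by
  set i0 : Fin K := ⟨0, by omega⟩
  set i1 : Fin K := ⟨1, hK⟩
  unfold start2r
  have e0 : (0 : ℕ) = E.enc (b i0) := by rw [hb0, E.enc_zero]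
  have e0' : (0 : ℕ) = E.enc (c i0) := by rw [hc0, E.enc_zero]
  conv => lhs; rw [show validNew E.g St2.empty 0 (E.enc (b' i0)) 0 (E.enc (c' i0)) =
    validNew E.g St2.empty (E.enc (b i0)) (E.enc (b' i0)) (E.enc (c i0)) (E.enc (c' i0)) by rw [← e0, ← e0'],
    show child2 E.g St2.empty 0 (E.enc (b' i0)) 0 (E.enc (c' i0))
        (fun S => level2rm E.g XB XC PP S xb xb2 (below2r E.g XB XC PP (K - 2))) =
      child2 E.g St2.empty (E.enc (b i0)) (E.enc (b' i0)) (E.enc (c i0)) (E.enc (c' i0))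
        (fun S => level2rm E.g XB XC PP S xb xb2 (below2r E.g XB XC PP (K - 2))) by rw [← e0, ← e0']]
  rw [validNew_true hM (invM2_empty E b b' c c') i0 rfl, child2_eq]
  have hS1 := invM2_childSt2 (E := E) (b := b) (b' := b') (c := c) (c' := c') i0 rfl (invM2_empty E b b' c c')
  have hlev : level2rm E.g XB XC PP (childSt2 E.g St2.empty (E.enc (b i0)) (E.enc (b' i0)) (E.enc (c i0)) (E.enc (c' i0)))
      xb xb2 (below2r E.g XB XC PP (K - 2)) = false :=
    level2rm_false hM hNF hP i1 rfl i0 rfl hS1 rfl (fun S' hS' hl' =>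
      below2r_false hM hNF hP (K - 2) 2 i1 S' (by omega) rfl hS' hl') hxb hxb2
  rw [hlev]; rfl


/-! ## The min-flag normal form (pair-class rank) and the reflection theorem -/

/-- PAIR-CLASS RANK from a list of pair masks: the index of the first mask whose bit `p` is set (the length if none). -/
noncomputable def prank (cls : List ℕ) (p : ℕ) : ℕ :=
  @List.rec ℕ (fun _ => ℕ) 0 (fun M _ ih => @Bool.rec (fun _ => ℕ) (Nat.add ih 1) 0 (Nat.testBit M p)) cls

/-- The rank of the pair of elements `(u, v)`: `prank` at the pair code `enc u · n + enc v`. -/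
noncomputable def prk (E : GEnc G) (cls : List ℕ) (u v : G) : ℕ := prank cls (E.enc u * E.g.n + E.enc v)

/-- ADEQUACY of an entry `(y, z, xb, xb2, XB, XC, PP)` for `n` codes and the class list `cls`: every pair of NONZERO codes
`(u, v)` whose rank, in both orders, is at least the rank of `(y, z)` is ALLOWED by `(XB, XC, PP)`. -/
def Adequate (n : ℕ) (cls : List ℕ) (e : ℕ × ℕ × ℕ × ℕ × ℕ × ℕ × ℕ) : Prop :=
  ∀ u, 0 < u → u < n → ∀ v, 0 < v → v < n → prank cls (e.1 * n + e.2.1) ≤ prank cls (u * n + v) →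
    prank cls (e.1 * n + e.2.1) ≤ prank cls (v * n + u) →
    e.2.2.2.2.1.testBit u = false ∧ e.2.2.2.2.2.1.testBit v = false ∧ e.2.2.2.2.2.2.testBit (u * n + v) = false

/-- Equality up to sign. -/
def SgnEq (x y : G) : Prop := x = y ∨ x = -y

/-- `SgnEq` through an additive map. -/
theorem SgnEq.map {x y : G} (h : SgnEq x y) (f : G →+ G) : SgnEq (f x) (f y) := by
  rcases h with rfl | rfl
  · exact Or.inl rfl
  · exact Or.inr (map_neg f y)

/-- `SgnEq` is transitive. -/
theorem SgnEq.trans {x y z : G} (h₁ : SgnEq x y) (h₂ : SgnEq y z) : SgnEq x z := by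
  rcases h₁ with rfl | rfl <;> rcases h₂ with rfl | rfl
  · exact Or.inl rfl
  · exact Or.inr rfl
  · exact Or.inr rfl
  · exact Or.inl (neg_neg _)

/-- The oriented difference of a pair equals the difference up to sign. -/
theorem sgnEq_orient (E : GEnc G) (s t : G) :
    SgnEq ((if E.enc s < E.enc t then t else s) - (if E.enc s < E.enc t then s else t)) (t - s) := by
  split_ifs
  · exact Or.inl rfl
  · exact Or.inr (neg_sub t s).symm

/-- A function of two elements that is invariant under sign changes takes equal values on sign-equal arguments. -/
theorem SgnEq.pr_eq {pr : G → G → ℕ} (hnegl : ∀ u v, pr (-u) v = pr u v) (hnegr : ∀ u v, pr u (-v) = pr u v)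
    {u u₀ v v₀ : G} (hu : SgnEq u u₀) (hv : SgnEq v v₀) : pr u v = pr u₀ v₀ := by
  rcases hu with rfl | rfl <;> rcases hv with rfl | rfl
  · rfl
  · rw [hnegr]
  · rw [hnegl]
  · rw [hnegl, hnegr]

end Refl

end STPP122Neg

end Summit.MatrixMultiplication.OmegaCensus
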